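/-
Copyright (c) 2026. All rights reserved.
Released under Apache 2.0 license as described in the file LICENSE.
Authors: abc-iut cell, seat abc-iut-w4-d095 (gen 6; row «PROP58-PF-VERTICES», ψ/ι/SETTING half, L4-lead m87/m88/m89), over
abc-iut-w6-d036's genuine containers and Prop 5.8 (vii) model, abc-iut-f-101's perfection containers and abc-iut-L4-t3's
`IotaAnMono` interface add-on (see the imports).
-/
import Literature.AnabelianGeometry.AbsoluteAnabelian.LogFrobeniusIotaAnMono
import Literature.AnabelianGeometry.AbsoluteAnabelian.AbsTopIII.MLFGaloisMonoAnabelianPerfections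
import HarnessLib

/-!
# [AbsTopIII] Prop 5.8 (vii) at the genuine mono-analytic MLF model WITH THE PERFECTION VERTICES:
# `ψ^{An⊢⊞}_{w,ν}` at `k~ = (𝒪^×_k̄)^pf` and `(k̄^×)^pf`, `ι^{An⊢⊞}_{w,ε}` for all four edges of `Γ⃗×_non`, the re-pointed setting

S. Mochizuki, *Topics in absolute anabelian geometry III: global reconstruction algorithms*, J. Math. Sci. Univ. Tokyo 22
(2015) 939–1156 [MochizukiAbsTopIII2015]; locators = pages of the author's manuscript (`paper:url-5493eb38cbb7`), read on
the page (own render): Prop 5.8 (ii) p. 139 l. 43–52 (the `Γ⃗×_non`-diagram `𝒪^×_k̄(G) ↪ k̄^×(G)`, `k~(G) ↪ (k̄^×)^pf(G)` with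
its two vertical arrows, "determined by the diagram of Definition 5.4, (iii)"), Prop 5.8 (vii) p. 141 l. 37 – p. 142 l. 6
("a 'forgetful functor' `ψ^{An⊢⊞}_{w,ν} : An⊢[𝒩⊢⊞_w] → 𝒩⊢⊞_w` … for each vertex `ν` of `Γ⃗×_w`, and a natural transformation
`ι^{An⊢⊞}_{w,ε} : ψ^{An⊢⊞}_{w,ν₁} → ψ^{An⊢⊞}_{w,ν₂}` for each edge `ε` of `Γ⃗×_w`"), Def 5.4 (iii) p. 126 (the six vertices / arrows of
`Γ⃗^log_non`; `Γ⃗×_non = Γ⃗^⋉_non ∩ Γ⃗^⋊_non`: vertices `𝒪^×_k̄`, `k̄^×`, `k~`, `(k̄^×)^pf`).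

## What this file does (node [AbsTopIII] Prop 5.8 (vii), clauses [c]/[d] of the cell's non-author count-read, layer L4)

abc-iut-w6-d036's `LogFrobeniusMonoGenuineProp58vii` (`nonarchGenuineMonoAn p`) realises `ψ^{An⊢⊞}_{w,ν}` GENUINELY at the
vertices `𝒪^×_k̄`, `k̄^×` but represents the PERFECTION vertices `k~ = (𝒪^×_k̄)^pf`, `(k̄^×)^pf` "by their sources" (its
`monoContainer`, stated HONEST LIMIT), and abc-iut-L4-t3's `LogFrobeniusIotaAnMono` types `ι^{An⊢⊞}` with the two perfection
arrows the IDENTITY under that representation.  Over abc-iut-f-101's GENUINE perfection containers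
(`AbsTopIII/MLFGaloisMonoAnabelianPerfections`: `kbarUnitsPf`, `kbarTimesPf : MonoBase ⥤ 𝒞_TS` on the torsion quotients
`𝒪^×_k̄/μ`, `k̄^×/μ` with the canonical LCFT transport descended, and the container-level arrows `kbarUnits ⟶ kbarUnitsPf`,
`kbarTimes ⟶ kbarTimesPf`, `kbarUnitsPf ⟶ kbarTimesPf`) this file RE-POINTS both:

* `MLFClosure.monoContainerPf` / `MLFClosure.ψMonoPf b ν` — `ψ^{An⊢⊞}_{w,ν}` reading the GENUINE container at EVERY vertex of
  `Γ⃗×_non`: `𝒪^× ↦ kbarUnits`, `k̄^× ↦ kbarTimes`, `k~ ↦ kbarUnitsPf`, `(k̄^×)^pf ↦ kbarTimesPf` (the non-core vertices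
  `k̄` (space-link) / post-log `k~`, which `ψ^{An⊢⊞}` never reads — Prop 5.8 (vii): "for each vertex `ν` of `Γ⃗×_w`" — and
  archimedean `w` — no archimedean component in this nonarchimedean model — keep stand-ins, labelled);
* `MLFClosure.monoContainerMapPf` / `MLFClosure.ιMonoPf b ε hε` — `ι^{An⊢⊞}_{w,ε}` for ALL FOUR edges of `Γ⃗×_non`:
  `𝒪^× ↪ k̄^×` (abc-iut-w6-d036's `kbarUnitsToTimes`), `𝒪^× → k~` and `k̄^× → (k̄^×)^pf` (abc-iut-f-101's torsion-quotient
  arrows — GENUINE, no longer identities), `k~ ↪ (k̄^×)^pf` (abc-iut-f-101's inclusion of quotients);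
* `LogFrobeniusSetting.nonarchGenuineMonoAnPf p Vmod isArc` — abc-iut-w6-d036's setting with `ψAnMono` re-pointed (every other
  row byte-identical): `ψ` over `ℰ⊢` on the nose, `hN`/`hκ` on the nose, `MonoAnalyticizationHomotopies` inhabited, Cor 5.10
  (iv)(a); and ★ `nonarchGenuineMonoAnPf_iotaAnMono : (nonarchGenuineMonoAnPf p Vmod isArc).IotaAnMono _` — abc-iut-L4-t3's
  add-on INHABITED with genuine perfection arrows.

HONEST FRAMING / LIMITS: MODEL-LEVEL (one nonarchimedean place type; archimedean `w` carries stand-in rows; `ℰ• := 𝒳`,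
`An• := 𝒳` placeholders as in abc-iut-w4-d095's settings; global theaters = campaign L); the decoration type of `An⊢` is
abc-iut-w6-d036's (the `Γ⃗×`-datum is determined by the base object, so the perfection containers are READ OFF the base —
the object part of "applying the algorithm of (ii)"); classical local class field theory as proved in the tree; refereed
pre-IUT material; nothing here bears on [IUTchIII] Cor. 3.12; no side taken; typed ≠ proved elsewhere.
-/

set_option autoImplicit false

noncomputable section

open CategoryTheory
namespace Literature.AnabelianGeometry.AbsoluteAnabelian

open AbsTopIII
open scoped nonZeroDivisors

namespace MLFClosure

/-! ## Part 1. `ψ^{An⊢⊞}_{w,ν}` reading the genuine container at every vertex of `Γ⃗×_non` -/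

/-- The container at a vertex of `Γ⃗^log_w` on the mono-analytic side, WITH the perfection vertices: `𝒪^×` ↦ `(G_k ↷ 𝒪^×_k̄)`,
`k̄^×` ↦ `(G_k ↷ k̄^×)`, `k~ = (𝒪^×_k̄)^pf` ↦ `(G_k ↷ 𝒪^×_k̄/μ)`, `(k̄^×)^pf` ↦ `(G_k ↷ k̄^×/μ)` (abc-iut-f-101's torsion-quotient
containers); stand-ins (never read by `ψ^{An⊢⊞}`, Prop 5.8 (vii) "for each vertex of `Γ⃗×_w`"): the space-link vertex `k̄` ↦
`k̄^×`, the post-log `k~` ↦ the perfection container of its shell-target, an archimedean `w` (no component here) ↦ `k̄^×`.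
[cite: MochizukiAbsTopIII2015, Prop 5.8 (ii) p. 139] -/
def monoContainerPf : (b : Bool) → LogVertex b → (MonoBase ⥤ TSObj)
  | false, NonarchVertex.units => kbarUnits
  | false, NonarchVertex.mult => kbarTimes
  | false, NonarchVertex.shellCod => kbarUnitsPf
  | false, NonarchVertex.perf => kbarTimesPf
  | false, NonarchVertex.postLog => kbarUnitsPf
  | false, NonarchVertex.spaceLink => kbarTimes
  | true, _ => kbarTimes

/-- At the two vertices `𝒪^×`, `k̄^×` the container is abc-iut-w6-d036's. [cite: MochizukiAbsTopIII2015, Prop 5.8 (ii) p. 139] -/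
theorem monoContainerPf_units_mult :
    monoContainerPf false NonarchVertex.units = kbarUnits ∧ monoContainerPf false NonarchVertex.mult = kbarTimes := ⟨rfl, rfl⟩

/-- At the two PERFECTION vertices the container is abc-iut-f-101's genuine torsion-quotient container (no longer the source).
[cite: MochizukiAbsTopIII2015, Prop 5.8 (ii) p. 139] -/
theorem monoContainerPf_shellCod_perf :
    monoContainerPf false NonarchVertex.shellCod = kbarUnitsPf ∧ monoContainerPf false NonarchVertex.perf = kbarTimesPf :=
  ⟨rfl, rfl⟩

/-- **`ψ^{An⊢⊞}_{w,ν} : An⊢[𝒩⊢⊞_w] → 𝒩⊢⊞_w = MonoBase × 𝒞_TS`** with the perfection vertices GENUINE: `(C, Γ⃗) ↦ (C, (G_k ↷ M_ν))`,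
on morphisms `α ↦ (α, (α, β_α))` resp. `(α, (α, β̄_α))` with `β̄_α` the descended transport.
[cite: MochizukiAbsTopIII2015, Prop 5.8 (vii) p.141] -/
def ψMonoPf (b : Bool) (ν : LogVertex b) : AnMono ⥤ MonoBase × TSObj :=
  inducedFunctor _ ⋙ (𝟭 MonoBase).prod' (monoContainerPf b ν)

/-- `ψ` lies over the base ON THE NOSE: `ψ_ν ⋙ pr₁ =` the forgetful functor `An⊢ → Th⊢`.
[cite: MochizukiAbsTopIII2015, Definition 5.6 (iii) p.136] -/
theorem ψMonoPf_fst (b : Bool) (ν : LogVertex b) :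
    ψMonoPf b ν ⋙ CategoryTheory.Prod.fst MonoBase TSObj = inducedFunctor _ := rfl

/-- At `𝒪^×` and `k̄^×`, `ψMonoPf` IS abc-iut-w6-d036's `ψMono`. [cite: MochizukiAbsTopIII2015, Prop 5.8 (vii) p.141] -/
theorem ψMonoPf_eq_ψMono_units_mult :
    ψMonoPf false NonarchVertex.units = ψMono false NonarchVertex.units ∧
      ψMonoPf false NonarchVertex.mult = ψMono false NonarchVertex.mult := ⟨rfl, rfl⟩

/-- `ψ` at the perfection vertex `(k̄^×)^pf` reads `(G_k ↷ k̄^×/μ)` off the base. [cite: MochizukiAbsTopIII2015, Prop 5.8 (vii) p.141] -/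
theorem ψMonoPf_perf_obj (X : AnMono) : (ψMonoPf false NonarchVertex.perf).obj X = (X.1, kbarTimesPf.obj X.1) := rfl

/-- `ψ` at the perfection vertex `k~ = (𝒪^×)^pf` reads `(G_k ↷ 𝒪^×_k̄/μ)` off the base. [cite: MochizukiAbsTopIII2015, Prop 5.8 (vii) p.141] -/
theorem ψMonoPf_shellCod_obj (X : AnMono) :
    (ψMonoPf false NonarchVertex.shellCod).obj X = (X.1, kbarUnitsPf.obj X.1) := rfl

/-- `ψ` at `(k̄^×)^pf` on a morphism of `Th⊢[Z]` (an ARBITRARY isomorphism of topological Galois groups): the `𝒞_TS`-component is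
abc-iut-f-101's `kbarTimesPf.map`, i.e. `(α, β̄_α)` with the descended canonical transport.
[cite: MochizukiAbsTopIII2015, Prop 5.8 (vii) p.141] -/
theorem ψMonoPf_perf_map {X Y : AnMono} (f : X ⟶ Y) :
    ((ψMonoPf false NonarchVertex.perf).map f).2 = kbarTimesPf.map f.hom := rfl

/-! ## Part 2. `ι^{An⊢⊞}_{w,ε}` for all four edges of `Γ⃗×_non`, with genuine perfection arrows -/

/-- The container map along an edge of `Γ⃗×_non`: `𝒪^× ↪ k̄^×` ↦ `kbarUnitsToTimes` (abc-iut-w6-d036); `𝒪^× → k~` and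
`k̄^× → (k̄^×)^pf` ↦ the GENUINE torsion-quotient arrows, `k~ ↪ (k̄^×)^pf` ↦ the inclusion of quotients (abc-iut-f-101); the
non-core arrow `k̄^× ↪ k̄` (space-link stand-in `k̄^×`) ↦ identity. [cite: MochizukiAbsTopIII2015, Prop 5.8 (vii) p. 142] -/
def nonarchMonoContainerMapPf : {ν₁ ν₂ : NonarchVertex} → (ε : NonarchEdge ν₁ ν₂) → ε.InCore →
    (monoContainerPf false ν₁ ⟶ monoContainerPf false ν₂)
  | _, _, .unitsToMult, _ => kbarUnitsToTimes
  | _, _, .multToSpaceLink, _ => 𝟙 kbarTimes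
  | _, _, .shell, _ => kbarUnitsToUnitsPf
  | _, _, .multToPerf, _ => kbarTimesToTimesPf
  | _, _, .postLogId, h => (NonarchEdge.not_inCore.2 h).elim
  | _, _, .shellCodToPerf, _ => kbarUnitsPfToTimesPf

/-- The container map along an edge of `Γ⃗×_w`, both kinds (archimedean `w`: stand-in identity, no component here).
[cite: MochizukiAbsTopIII2015, Prop 5.8 (vii) p. 142] -/
def monoContainerMapPf : (b : Bool) → {ν₁ ν₂ : LogVertex b} → (ε : LogEdgeTS b ν₁ ν₂) → ε.InCore →
    (monoContainerPf b ν₁ ⟶ monoContainerPf b ν₂)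
  | false, _, _, ε, hε => nonarchMonoContainerMapPf ε hε
  | true, _, _, _, _ => 𝟙 kbarTimes

/-- **`ι^{An⊢⊞}_{w,ε}` with genuine perfection arrows, for EVERY edge `ε` of `Γ⃗×_w`**: the identity on the base component, the
container map on the `𝒞_TS`-component. [cite: MochizukiAbsTopIII2015, Prop 5.8 (vii) p. 142] -/
def ιMonoPf (b : Bool) {ν₁ ν₂ : LogVertex b} (ε : LogEdgeTS b ν₁ ν₂) (hε : ε.InCore) :
    ψMonoPf b ν₁ ⟶ ψMonoPf b ν₂ :=
  Functor.whiskerLeft (inducedFunctor _) (NatTrans.prod' (𝟙 (𝟭 MonoBase)) (monoContainerMapPf b ε hε))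

/-- Along `𝒪^× ↪ k̄^×` this IS abc-iut-w6-d036's `ιMonoUnitsToMult` (= abc-iut-L4-t3's `ιMono` there).
[cite: MochizukiAbsTopIII2015, Prop 5.8 (vii) p. 142] -/
theorem ιMonoPf_unitsToMult (h : LogEdgeTS.InCore (b := false) NonarchEdge.unitsToMult) :
    ιMonoPf false NonarchEdge.unitsToMult h = ιMonoUnitsToMult := rfl

/-- Along the shell-arrow `𝒪^× → k~` the `𝒞_TS`-component of `ι^{An⊢⊞}` is abc-iut-f-101's GENUINE torsion-quotient arrow
`kbarUnits ⟶ kbarUnitsPf` (no longer an identity). [cite: MochizukiAbsTopIII2015, Prop 5.8 (vii) p. 142] -/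
theorem ιMonoPf_shell_app_snd (h : LogEdgeTS.InCore (b := false) NonarchEdge.shell) (X : AnMono) :
    ((ιMonoPf false NonarchEdge.shell h).app X).2 = kbarUnitsToUnitsPf.app X.1 := rfl

/-- Along `k̄^× → (k̄^×)^pf` the `𝒞_TS`-component is abc-iut-f-101's `kbarTimes ⟶ kbarTimesPf`.
[cite: MochizukiAbsTopIII2015, Prop 5.8 (vii) p. 142] -/
theorem ιMonoPf_multToPerf_app_snd (h : LogEdgeTS.InCore (b := false) NonarchEdge.multToPerf) (X : AnMono) :
    ((ιMonoPf false NonarchEdge.multToPerf h).app X).2 = kbarTimesToTimesPf.app X.1 := rfl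

/-- Along `k~ ↪ (k̄^×)^pf` the `𝒞_TS`-component is abc-iut-f-101's inclusion of quotients `kbarUnitsPf ⟶ kbarTimesPf`.
[cite: MochizukiAbsTopIII2015, Prop 5.8 (vii) p. 142] -/
theorem ιMonoPf_shellCodToPerf_app_snd (h : LogEdgeTS.InCore (b := false) NonarchEdge.shellCodToPerf) (X : AnMono) :
    ((ιMonoPf false NonarchEdge.shellCodToPerf h).app X).2 = kbarUnitsPfToTimesPf.app X.1 := rfl

/-- `ι^{An⊢⊞}_{w,ε}` is the identity on the base component (it lies over `Th⊢[Z]` on the nose).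
[cite: MochizukiAbsTopIII2015, Prop 5.8 (vii) p. 142] -/
theorem ιMonoPf_app_fst (b : Bool) {ν₁ ν₂ : LogVertex b} (ε : LogEdgeTS b ν₁ ν₂) (hε : ε.InCore) (X : AnMono) :
    ((ιMonoPf b ε hε).app X).1 = 𝟙 X.1 := rfl

end MLFClosure

/-! ## Part 3. The re-pointed §5 setting -/

namespace LogFrobeniusSetting

variable (p : ℕ) [Fact p.Prime]

/-- **abc-iut-w6-d036's genuine mono-analytic §5 setting with `ψ^{An⊢⊞}` RE-POINTED to the genuine perfection containers**:
every row of `nonarchGenuineMonoAn p` unchanged except `ψAnMono w ν := ψMonoPf (isArc w) ν`.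
[cite: MochizukiAbsTopIII2015, Prop 5.8 (vii) p.141] -/
def nonarchGenuineMonoAnPf (Vmod : Type 1) (isArc : Vmod → Bool) : LogFrobeniusSetting Vmod isArc where
  X := Up (TFModel p)
  E := Up (TFModel p)
  proj := 𝟭 _
  log := 𝟭 _
  logIsoId := Iso.refl _
  logOver := Iso.refl _
  Nplus _ := Up (TFModel p × TSObj)
  N _ := Up (TFModel p × TSObj)
  forget _ := 𝟭 _
  toE _ := Up.liftF (CategoryTheory.Prod.fst (TFModel p) TSObj)
  lam v := nonarchLam p (isArc v)
  lamOver v := nonarchLamOver p (isArc v)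
  lam_spaceLink_eq_postLog v := nonarchLam_spaceLink_eq_postLog p (isArc v)
  iota v _ _ ε := nonarchIota p (isArc v) ε
  An := Up (TFModel p)
  κAn := CategoryTheory.Equivalence.refl
  φAn := 𝟭 _
  φAn_isEquivalence := inferInstance
  ηAn := Iso.refl _
  κAn₂ := CategoryTheory.Equivalence.refl
  Emono := Up MLFClosure.MonoBase
  monoAn := Up.liftF (TFModel.toMonoBase p)
  NmonoPlus _ := Up (MLFClosure.MonoBase × TSObj)
  Nmono _ := Up (MLFClosure.MonoBase × TSObj)
  forgetMono _ := 𝟭 _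
  toEmono _ := Up.liftF (CategoryTheory.Prod.fst MLFClosure.MonoBase TSObj)
  monoNplus _ := nonarchMonoNAn p
  monoN _ := nonarchMonoNAn p
  monoHomotopy _ := Iso.refl _
  AnMono := Up MLFClosure.AnMono
  κAnMono := Up.liftE MLFClosure.anMonoEquiv
  ψAnMono w ν := Up.liftF (MLFClosure.ψMonoPf (isArc w) ν.1)

variable (Vmod : Type 1) (isArc : Vmod → Bool)

/-- `ψ^{An⊢⊞}_{w,ν}` of the re-pointed setting IS `ψMonoPf`. [cite: MochizukiAbsTopIII2015, Prop 5.8 (vii) p.141] -/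
theorem nonarchGenuineMonoAnPf_ψAnMono (w : Vmod) (ν : {ν : LogVertex (isArc w) // ν.IsCross}) :
    (nonarchGenuineMonoAnPf p Vmod isArc).ψAnMono w ν = Up.liftF (MLFClosure.ψMonoPf (isArc w) ν.1) := rfl

/-- All the other rows are abc-iut-w6-d036's (the mono-analytic base, `An⊢`, `κ`, the holomorphic rows).
[cite: MochizukiAbsTopIII2015, Prop 5.8 (vii) p.141] -/
theorem nonarchGenuineMonoAnPf_Emono_AnMono :
    (nonarchGenuineMonoAnPf p Vmod isArc).Emono = Up MLFClosure.MonoBase ∧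
      (nonarchGenuineMonoAnPf p Vmod isArc).AnMono = Up MLFClosure.AnMono := ⟨rfl, rfl⟩

/-- **`ψ^{An⊢⊞}_{w,ν}` lies over `ℰ⊢` ON THE NOSE** at the re-pointed setting (the (c)-leg `ψOver`).
[cite: MochizukiAbsTopIII2015, Definition 5.6 (iii) p.136] -/
theorem nonarchGenuineMonoAnPf_ψOver (w : Vmod) (ν : {ν : LogVertex (isArc w) // ν.IsCross}) :
    (nonarchGenuineMonoAnPf p Vmod isArc).ψAnMono w ν ⋙ (nonarchGenuineMonoAnPf p Vmod isArc).forgetMono w ⋙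
        (nonarchGenuineMonoAnPf p Vmod isArc).toEmono w =
      (nonarchGenuineMonoAnPf p Vmod isArc).κAnMono.inverse := rfl

/-- rows 4 → 5 (`hN`) ON THE NOSE (unchanged from abc-iut-w6-d036). [cite: MochizukiAbsTopIII2015, Cor 5.10 p. 146] -/
theorem nonarchGenuineMonoAnPf_monoN_toEmono_eq (v : Vmod) :
    (nonarchGenuineMonoAnPf p Vmod isArc).monoN v ⋙ (nonarchGenuineMonoAnPf p Vmod isArc).toEmono v =
      (nonarchGenuineMonoAnPf p Vmod isArc).toE v ⋙ (nonarchGenuineMonoAnPf p Vmod isArc).monoAn := rfl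

/-- rows 6 → 7 (`hκ`) ON THE NOSE (unchanged). [cite: MochizukiAbsTopIII2015, Cor 5.10 p. 146] -/
theorem nonarchGenuineMonoAnPf_κAn₂_monoAn_eq :
    (nonarchGenuineMonoAnPf p Vmod isArc).κAn₂.functor ⋙ (nonarchGenuineMonoAnPf p Vmod isArc).monoAn =
      (nonarchGenuineMonoAnPf p Vmod isArc).κAn.inverse ⋙ (nonarchGenuineMonoAnPf p Vmod isArc).monoAn := rfl

/-- abc-iut-L4-t3's `MonoAnalyticizationHomotopies` is INHABITED at the re-pointed setting (same witnesses as abc-iut-w6-d036's).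
[cite: MochizukiAbsTopIII2015, Cor 5.10 p. 146] -/
def nonarchGenuineMonoAnPf_monoAnalyticizationHomotopies :
    (nonarchGenuineMonoAnPf p Vmod isArc).MonoAnalyticizationHomotopies where
  toE v := eqToIso (nonarchGenuineMonoAnPf_monoN_toEmono_eq p Vmod isArc v)
  anToE := Functor.isoWhiskerLeft
    ((nonarchGenuineMonoAnPf p Vmod isArc).κAn.inverse ⋙ (nonarchGenuineMonoAnPf p Vmod isArc).monoAn)
    (nonarchGenuineMonoAnPf p Vmod isArc).κAnMono.unitIso.symm

/-- **[AbsTopIII] Cor 5.10 (iv)(a) HOLDS at the re-pointed setting** (abc-iut-L4-t3's `cor510MonoCores_holds`).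
[cite: MochizukiAbsTopIII2015, Cor 5.10 (iv)(a) p.147] -/
theorem nonarchGenuineMonoAnPf_cor510MonoCores [Nonempty Vmod] : (nonarchGenuineMonoAnPf p Vmod isArc).Cor510MonoCores :=
  cor510MonoCores_holds (nonarchGenuineMonoAnPf_monoAnalyticizationHomotopies p Vmod isArc)

/-- `ψ` over `ℰ⊢` on the nose ⇒ the identity isomorphisms are a legitimate `hψ` for abc-iut-L4-t3's add-on.
[cite: MochizukiAbsTopIII2015, Definition 5.6 (iii) p. 136] -/
def nonarchGenuineMonoAnPf_ψOverIso (w : Vmod) (j : {ν : LogVertex (isArc w) // ν.IsCross}) :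
    (nonarchGenuineMonoAnPf p Vmod isArc).ψAnMono w j ⋙ (nonarchGenuineMonoAnPf p Vmod isArc).forgetMono w ⋙
        (nonarchGenuineMonoAnPf p Vmod isArc).toEmono w ≅
      (nonarchGenuineMonoAnPf p Vmod isArc).κAnMono.inverse :=
  eqToIso (nonarchGenuineMonoAnPf_ψOver p Vmod isArc w j)

/-- ★ **abc-iut-L4-t3's add-on `IotaAnMono` INHABITED at the re-pointed setting with GENUINE perfection arrows**:
`ι^{An⊢⊞}_{w,ε} := Up.liftT (ιMonoPf (isArc w) ε)` for every edge of `Γ⃗×_w`, lying over `Th⊢[Z]` on the nose; along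
`𝒪^× → k~` and `k̄^× → (k̄^×)^pf` these are abc-iut-f-101's torsion-quotient arrows, along `k~ ↪ (k̄^×)^pf` the inclusion of
quotients. [cite: MochizukiAbsTopIII2015, Prop 5.8 (vii) p. 142] -/
def nonarchGenuineMonoAnPf_iotaAnMono :
    (nonarchGenuineMonoAnPf p Vmod isArc).IotaAnMono (nonarchGenuineMonoAnPf_ψOverIso p Vmod isArc) where
  ι w _ _ ε hε := Up.liftT (MLFClosure.ιMonoPf (isArc w) ε hε)
  ι_over w ν₁ ν₂ ε hε X := by
    apply InducedCategory.hom_ext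
    simp only [nonarchGenuineMonoAnPf_ψOverIso, eqToIso.hom, eqToIso.inv, eqToHom_app, eqToHom_trans]
    rfl

include p in
/-- **Prop 5.8 (vii) at the genuine model WITH perfection vertices, summary**: a §5 setting with `ℰ⊢` the genuine groupoid of
absolute Galois groups, `An⊢` print's decorated category, `ψ^{An⊢⊞}` GENUINE at all four vertices of `Γ⃗×_non` and over `ℰ⊢`
on the nose, `ι^{An⊢⊞}` for all four edges (add-on inhabited), and Cor 5.10 (iv)(a) for `V(F_mod) ≠ ∅`.
[cite: MochizukiAbsTopIII2015, Prop 5.8 (vii) p.141] -/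
theorem exists_genuine_prop58vii_pf :
    ∃ (L : LogFrobeniusSetting Vmod isArc)
      (hψ : ∀ (w : Vmod) (j : {ν : LogVertex (isArc w) // ν.IsCross}),
        L.ψAnMono w j ⋙ L.forgetMono w ⋙ L.toEmono w ≅ L.κAnMono.inverse),
      L.Emono = Up MLFClosure.MonoBase ∧ L.AnMono = Up MLFClosure.AnMono ∧
      Nonempty (L.IotaAnMono hψ) ∧ (Nonempty Vmod → L.Cor510MonoCores) :=
  ⟨nonarchGenuineMonoAnPf p Vmod isArc, nonarchGenuineMonoAnPf_ψOverIso p Vmod isArc, rfl, rfl,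
    ⟨nonarchGenuineMonoAnPf_iotaAnMono p Vmod isArc⟩,
    fun h => haveI := h; nonarchGenuineMonoAnPf_cor510MonoCores p Vmod isArc⟩

end LogFrobeniusSetting

end Literature.AnabelianGeometry.AbsoluteAnabelian

end
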